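import Mathlib
import HarnessLib
import Summits.Parity.BatemanHorn.Theses.RoughValueTransport
import Literature.NumberTheory.Sieve.BombieriAsymptoticSieveSmoothPart

/-!
# Sketch — crux-ideate stmt-Parity-11390 (RoughValueLaw), idea `friable-deep-tail`

First-lemma signatures only (no skeleton at this stage). Everything is stated over existing
declarations: `Literature.NumberTheory.Sieve.smoothPart B N` (the `B`-friable part of `N`,
primes `p < B`), Mathlib's `ArithmeticFunction.moebius`, and the crux decl
`Summit.Parity.BatemanHorn.Theses.RoughValueTransport.RoughValueLaw`.
-/

namespace Summit.Parity.BatemanHorn.Cruxes.RoughValueLaw.FriableDeepTail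

open Finset ArithmeticFunction Literature.NumberTheory.Sieve

/-- Level-`D` TYPE-I kernel on a vector of friable parts `s = (s₁,…,s_k)`:
`Σ_{d : dᵢ ∣ sᵢ, ∏ dᵢ ≤ D} ∏ᵢ μ(dᵢ)`. -/
noncomputable def typeIKernel {k : ℕ} (D : ℕ) (s : Fin k → ℕ) : ℤ :=
  ∑ d ∈ (Fintype.piFinset fun i => (s i).divisors) with (∏ i, d i) ≤ D, ∏ i, (ArithmeticFunction.moebius (d i) : ℤ)

/-- Level-`D` DEEP kernel (the parity-carrying, `f`-independent combinatorial weight):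
`h_D(s) = Σ_{d : dᵢ ∣ sᵢ, ∏ dᵢ > D} ∏ᵢ μ(dᵢ)`; it vanishes unless `∏ sᵢ > D`. -/
noncomputable def deepKernel {k : ℕ} (D : ℕ) (s : Fin k → ℕ) : ℤ :=
  ∑ d ∈ (Fintype.piFinset fun i => (s i).divisors) with D < (∏ i, d i), ∏ i, (ArithmeticFunction.moebius (d i) : ℤ)

/-- The vector of friable parts of the values at `n`: `sᵢ(n) = (Bᵢ-friable part of fᵢ(n))`. -/
noncomputable def friableParts {k : ℕ} (f : Fin k → Polynomial ℤ) (B : Fin k → ℕ) (n : ℕ) :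
    Fin k → ℕ :=
  fun i => smoothPart (B i) ((f i).eval (n : ℤ)).toNat

/-- FIRST LEMMA (FriableDecomposition, provable now — Legendre per coordinate, split at level `D`):
the crux's inline rough-value count equals the Type-I part plus the deep tail, and the deep tail
is supported on the `n` whose friable parts have product `> D` (Tenenbaum's "large friable
component" set). With `Bᵢ = ⌈x^{deg fᵢ/u}⌉₊` the left side is literally the finset of
`RoughValueLaw`. -/
def FriableDecomposition : Prop :=
  ∀ (k : ℕ) (f : Fin k → Polynomial ℤ) (B : Fin k → ℕ) (D x : ℕ),
    ((((Icc 1 x).filter (fun n : ℕ => ∀ i, 0 < (f i).eval (n : ℤ) ∧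
        ∀ p ∈ range (B i), p.Prime → ¬ ((p : ℤ) ∣ (f i).eval (n : ℤ)))).card : ℤ)
      = ∑ n ∈ (Icc 1 x).filter (fun n : ℕ => ∀ i, 0 < (f i).eval (n : ℤ)),
          (typeIKernel D (friableParts f B n) + deepKernel D (friableParts f B n)))
    ∧ ∀ (s : Fin k → ℕ), (∀ i, 0 < s i) → (∏ i, s i) ≤ D → deepKernel D s = 0

/-- SUPPORT (TypeIProfile, provable now by fundamental-lemma-type analysis of the truncated
singular series; remainders are trivial since every modulus is `≤ x^{1-η}`): the level-`x^{1-η}`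
Type-I part of `Φ_f(x,u)` has a limit after the crux's normalisation. -/
def TypeIProfile : Prop :=
  ∀ (k : ℕ) (f : Fin k → Polynomial ℤ), IsBatemanHornSystem f →
    ∀ (u η : ℝ), 2 < u → 0 < η → η < 1 →
      ∃ M : ℝ, Filter.Tendsto (fun x : ℕ =>
        ((∑ n ∈ (Icc 1 x).filter (fun n : ℕ => ∀ i, 0 < (f i).eval (n : ℤ)),
            typeIKernel ⌊(x : ℝ) ^ (1 - η)⌋₊
              (friableParts f (fun i => ⌈(x : ℝ) ^ (((f i).natDegree : ℝ) / u)⌉₊) n) : ℤ) : ℝ)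
          * Real.log x ^ k / (x : ℝ)) Filter.atTop (nhds M)

/-- TRANSFER TARGET (DeepTailLaw): the deep tail — a signed count, with the `f`-independent
kernel `h_D`, over the `n ≤ x` whose friable parts have product `> x^{1-η}` — has a limit for
every depth `u > 2`, and together with the Type-I limit it reproduces the Buchstab shape with a
free constant. Given `FriableDecomposition` and `TypeIProfile`, this is equivalent to the crux;
its content is WHERE the parity lives (see the card). -/
def DeepTailLaw : Prop :=
  ∀ (k : ℕ) (f : Fin k → Polynomial ℤ), IsBatemanHornSystem f →
    ∀ ω : ℝ → ℝ, ((∀ u : ℝ, 1 ≤ u → u ≤ 2 → ω u = u⁻¹) ∧ ContinuousOn ω (Set.Ici 1) ∧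
      (∀ u : ℝ, 2 < u → HasDerivAt (fun t : ℝ => t * ω t) (ω (u - 1)) u)) →
    ∃ A : ℝ, ∀ (u η : ℝ), 2 < u → 0 < η → η < 1 →
      ∃ M T : ℝ,
        Filter.Tendsto (fun x : ℕ =>
          ((∑ n ∈ (Icc 1 x).filter (fun n : ℕ => ∀ i, 0 < (f i).eval (n : ℤ)),
              typeIKernel ⌊(x : ℝ) ^ (1 - η)⌋₊
                (friableParts f (fun i => ⌈(x : ℝ) ^ (((f i).natDegree : ℝ) / u)⌉₊) n) : ℤ) : ℝ)
            * Real.log x ^ k / (x : ℝ)) Filter.atTop (nhds M) ∧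
        Filter.Tendsto (fun x : ℕ =>
          ((∑ n ∈ (Icc 1 x).filter (fun n : ℕ => ∀ i, 0 < (f i).eval (n : ℤ)),
              deepKernel ⌊(x : ℝ) ^ (1 - η)⌋₊
                (friableParts f (fun i => ⌈(x : ℝ) ^ (((f i).natDegree : ℝ) / u)⌉₊) n) : ℤ) : ℝ)
            * Real.log x ^ k / (x : ℝ)) Filter.atTop (nhds T) ∧
        M + T = A * (u * ω u) ^ k

/-- Sanity: the transfer closes the crux by name (statement only; the proof is bookkeeping
from `FriableDecomposition` + `Filter.Tendsto.add`, left for crux-plan). -/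
def TransferClosesCrux : Prop :=
  FriableDecomposition → DeepTailLaw →
    Summit.Parity.BatemanHorn.Theses.RoughValueTransport.RoughValueLaw

end Summit.Parity.BatemanHorn.Cruxes.RoughValueLaw.FriableDeepTail
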